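import Literature.NumberTheory.PAdicHodge.TateSenCocyclesGL
import Literature.NumberTheory.PAdicHodge.TateSenConditionHolds
import Literature.NumberTheory.PAdicHodge.TateSenConditionCompletedAlgClosure
import Mathlib.FieldTheory.KrullTopology
import HarnessLib

/-!
# Sen's `H`-descent for `GL_d`, unconditionally: `H¹_cont(H₀, GL_d(ℂ_F)) = 1` near the identity

`H₀ = ker χ = Gal(F̄/K₀(μ_{p^∞})) ≤ G₀ = Gal(F̄/K₀)` (`K₀ = PadicBase F p hp ≅ ℚ_p`, tree `BaseGaloisGroup hp`,
`(baseCyclotomicCharacter hp).ker` with the induced profinite topology) acts on `ℂ_F = CompletedAlgClosure F`.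
By the tree's THEOREM `tate1967_TS1_completedAlgClosure_holds` (Tate 1967 §3.2 Prop. 9 = Berger–Colmez
(TS1), proved by the Kummer route) and the abstract `GL_d` descent `TateSen.GL_exists_conj_eq_one_of_TS1`
(Berger–Colmez Lemme 3.2.1 / Cor. 3.2.2):

* ★ `TateSen.baseKer_GL_exists_conj_eq_one` — **there is a constant `K ≥ 1` (depending on `F`, `p`) such
  that every continuous `1`-cocycle `σ ↦ U_σ : H₀ → M_d(ℂ_F)` with `‖U_σ − 1‖ ≤ s` for all `σ` and `K s < 1`
  is a coboundary near `1`: `P⁻¹ U_σ σ(P) = 1` for some `P ∈ GL_d(ℂ_F)` with `‖P − 1‖ ≤ K s`.**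

This is the first (descent to `H`) half of Sen's theorem on `H¹(G_K, GL_d(ℂ_p))`, UNCONDITIONAL; the second
half (decompletion along `Γ = G₀/H₀` via Tate's normalised traces) is `SenDecompletionMatrix` /
`SenDecompletionCocycle`. No named facts remain.

References: Berger–Colmez, Astérisque 319 (2008), Lemme 3.2.1, Cor. 3.2.2, Prop. 4.1.1 [BergerColmez2008];
S. Sen, Invent. Math. 62 (1980), §1 [Sen1980]; J. Tate, *p-divisible groups* (1967), §3.2 Prop. 9–10 [Tate1967].
-/

noncomputable section

open scoped Topology
open Filter

namespace Literature.NumberTheory.PAdicHodge.TateSen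

open UniformSpace Field ValuativeRel
open Literature.NumberTheory.GaloisRepresentations
open Literature.NumberTheory.GaloisRepresentations.IsNonarchimedeanLocalField

variable {F : Type} [Field F] [ValuativeRel F] [TopologicalSpace F] [IsNonarchimedeanLocalField F]
  [CharZero F] {p : ℕ} [Fact p.Prime] (hp : valuation F p < 1)

omit [ValuativeRel F] [TopologicalSpace F] [IsNonarchimedeanLocalField F] [CharZero F] [Fact p.Prime] in
/-- Every neighbourhood of `1` in a subgroup `H` of a Galois group `Gal(L/K)` (induced Krull topology) contains
an open subgroup of `H`. (Private copy of the helper in `TateSenCocycles`.) [folklore] -/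
private theorem exists_openSubgroup_subset_gal' {K L : Type*} [Field K] [Field L] [Algebra K L]
    (H : Subgroup (L ≃ₐ[K] L)) {V : Set H} (hV : V ∈ 𝓝 (1 : H)) :
    ∃ U : OpenSubgroup H, (U : Set H) ⊆ V := by
  obtain ⟨W, hW, hWV⟩ := (mem_nhds_subtype _ _ _).mp hV
  rw [OneMemClass.coe_one] at hW
  obtain ⟨E, hfin, hE⟩ := (krullTopology_mem_nhds_one_iff K L W).mp hW
  haveI := hfin
  refine ⟨⟨E.fixingSubgroup.subgroupOf H, Subgroup.subgroupOf_isOpen H _ E.fixingSubgroup_isOpen⟩, ?_⟩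
  intro h hh
  exact hWV (hE (Subgroup.mem_subgroupOf.mp hh))

/-- `H₀ = ker χ` is closed in `G₀`. (Private copy of the helper in `TateSenCocycles`.) [folklore] -/
private theorem isClosed_baseKer' :
    IsClosed (((BaseGaloisGroup.baseCyclotomicCharacter hp).ker : Subgroup (BaseGaloisGroup hp)) :
      Set (BaseGaloisGroup hp)) := by
  have h : (((BaseGaloisGroup.baseCyclotomicCharacter hp).ker : Subgroup (BaseGaloisGroup hp)) :
      Set (BaseGaloisGroup hp)) = (BaseGaloisGroup.baseCyclotomicCharacter hp) ⁻¹' {1} := by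
    ext g
    exact MonoidHom.mem_ker
  rw [h]
  exact isClosed_singleton.preimage
    (cyclotomicCharacter.continuous p (PadicBase F p hp) (NormedAlgClosure F))

/-- **(TS1) for `ℂ_F` in the quotient form**, unconditionally: there is `K` such that every open subgroup
`U ≤ H₀` admits a `U`-invariant `α ∈ ℂ_F` with `‖α‖ ≤ K` and `∑_{q ∈ H₀/U} q(α) = 1` (representatives
`q ↦ q.out`). From the tree theorem `tate1967_TS1_completedAlgClosure_holds`.
[cite: Tate1967, §3.2 Prop. 9] [cite: BergerColmez2008, Prop. 4.1.1] -/
theorem baseKer_TS1_out :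
    ∃ K : ℝ, ∀ U : OpenSubgroup (BaseGaloisGroup.baseCyclotomicCharacter hp).ker,
      ∃ α : CompletedAlgClosure F, (∀ u ∈ U, u • α = α) ∧ ‖α‖ ≤ K ∧
        ∑ᶠ q : (BaseGaloisGroup.baseCyclotomicCharacter hp).ker ⧸ U.toSubgroup, q.out • α = 1 := by
  classical
  haveI : IsGalois (PadicBase F p hp) (NormedAlgClosure F) := inferInstance
  haveI : CompactSpace (BaseGaloisGroup.baseCyclotomicCharacter hp).ker :=
    isCompact_iff_compactSpace.mp (isClosed_baseKer' hp).isCompact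
  obtain ⟨K, hK⟩ := tate1967_TS1_completedAlgClosure_holds hp
  refine ⟨K, fun U => ?_⟩
  haveI : Fintype ((BaseGaloisGroup.baseCyclotomicCharacter hp).ker ⧸ U.toSubgroup) := Fintype.ofFinite _
  set S : Finset (BaseGaloisGroup.baseCyclotomicCharacter hp).ker :=
    Finset.univ.image (fun q : (BaseGaloisGroup.baseCyclotomicCharacter hp).ker ⧸ U.toSubgroup => q.out)
    with hS
  have hrep : ∀ h ∈ (⊤ : OpenSubgroup (BaseGaloisGroup.baseCyclotomicCharacter hp).ker),
      ∃! s, s ∈ S ∧ s⁻¹ * h ∈ U := by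
    intro h _
    refine ⟨(QuotientGroup.mk h : _ ⧸ U.toSubgroup).out, ⟨?_, ?_⟩, ?_⟩
    · exact Finset.mem_image.mpr ⟨QuotientGroup.mk h, Finset.mem_univ _, rfl⟩
    · exact QuotientGroup.eq.mp (QuotientGroup.out_eq' (QuotientGroup.mk h : _ ⧸ U.toSubgroup))
    · rintro s ⟨hs, hsU⟩
      obtain ⟨q, -, rfl⟩ := Finset.mem_image.mp hs
      have hq : (QuotientGroup.mk q.out : _ ⧸ U.toSubgroup) = QuotientGroup.mk h := QuotientGroup.eq.mpr hsU
      rw [QuotientGroup.out_eq'] at hq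
      rw [hq]
  obtain ⟨α, hαU, hαK, hαS⟩ := hK U ⊤ le_top S (fun s _ => trivial) hrep
  refine ⟨α, hαU, hαK, ?_⟩
  rw [finsum_eq_sum_of_fintype, ← hαS, hS, Finset.sum_image]
  intro q₁ _ q₂ _ h
  exact Quotient.out_injective h

/-- ★ **Sen's `H`-descent for `GL_d`, unconditionally (Berger–Colmez Cor. 3.2.2 with (TS1) = Tate's
Prop. 9 discharged).** There is a constant `K ≥ 1` such that for every finite index type `m`, every
continuous `1`-cocycle `σ ↦ U_σ : H₀ → M_m(ℂ_F)` (`U_{στ} = U_σ σ(U_τ)`, entrywise action) with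
`‖U_σ − 1‖ ≤ s` entrywise for all `σ ∈ H₀`, where `0 < s` and `K s < 1`, there is `P ∈ GL_m(ℂ_F)` with
`‖P − 1‖ ≤ K s` and `P⁻¹ U_σ σ(P) = 1` for all `σ ∈ H₀`. [cite: BergerColmez2008, Lemme 3.2.1 and Cor. 3.2.2]
[cite: Sen1980, §1] [cite: Tate1967, §3.2 Prop. 9 and Prop. 10] -/
theorem baseKer_GL_exists_conj_eq_one :
    ∃ K : ℝ, 1 ≤ K ∧ ∀ {m : Type} [Fintype m] [DecidableEq m]
      (U : (BaseGaloisGroup.baseCyclotomicCharacter hp).ker → Matrix m m (CompletedAlgClosure F)),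
      (∀ g h : (BaseGaloisGroup.baseCyclotomicCharacter hp).ker,
          U (g * h) = U g * (U h).map fun x => g • x) →
      Continuous U → ∀ {s : ℝ}, 0 < s → K * s < 1 → (∀ g i j, ‖(U g - 1) i j‖ ≤ s) →
        ∃ P : Matrix m m (CompletedAlgClosure F), (∀ i j, ‖(P - 1) i j‖ ≤ K * s) ∧ IsUnit P.det ∧
          ∀ g : (BaseGaloisGroup.baseCyclotomicCharacter hp).ker, P⁻¹ * U g * P.map (fun x => g • x) = 1 := by
  haveI : IsGalois (PadicBase F p hp) (NormedAlgClosure F) := inferInstance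
  haveI : CompactSpace (BaseGaloisGroup.baseCyclotomicCharacter hp).ker :=
    isCompact_iff_compactSpace.mp (isClosed_baseKer' hp).isCompact
  obtain ⟨K₀, hK₀⟩ := baseKer_TS1_out hp
  refine ⟨max K₀ 1, le_max_right _ _, ?_⟩
  intro m _ _ U hU hcont s hs hsK hbd
  have hTS' : ∀ U : OpenSubgroup (BaseGaloisGroup.baseCyclotomicCharacter hp).ker,
      ∃ α : CompletedAlgClosure F, (∀ u ∈ U, u • α = α) ∧ ‖α‖ ≤ max K₀ 1 ∧
        ∑ᶠ q : (BaseGaloisGroup.baseCyclotomicCharacter hp).ker ⧸ U.toSubgroup, q.out • α = 1 := fun U => by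
    obtain ⟨α, h1, h2, h3⟩ := hK₀ U
    exact ⟨α, h1, h2.trans (le_max_left _ _), h3⟩
  exact GL_exists_conj_eq_one_of_TS1 (G := (BaseGaloisGroup.baseCyclotomicCharacter hp).ker)
    (C := CompletedAlgClosure F)
    (fun g x => CompletedAlgClosure.norm_base_smul hp (g : BaseGaloisGroup hp) x)
    (fun x => (continuous_base_smul_left hp x).comp continuous_subtype_val)
    (fun V hV => exists_openSubgroup_subset_gal' _ hV) (le_max_right _ _) hTS' U hU hcont hs hsK hbd

end Literature.NumberTheory.PAdicHodge.TateSen
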